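import Summits.Ventures.DiscreteObjects.UnitDistance.SpectralUnitBall
import Summits.Ventures.DiscreteObjects.UnitDistance.ValuationRingReduction
import Summits.Ventures.DiscreteObjects.UnitDistance.PadicReduction
import Summits.Ventures.DiscreteObjects.UnitDistance.MoserLocalData
import Mathlib.NumberTheory.Padics.RingHoms

/-!
# The 3-adic reduction for ramified quadratic extensions of `ℚ₃` (cell `pub-namedobj`, target (U), seat udg g11)

Framing (verbatim for the cell): lottery ticket; floor = certified bounds/negative ranges.

Companion of the 2-adic criterion (`MultiquadraticCriterion`): THREE colours.  Madore 2015 (arXiv:1509.07023, Prop. 3.1 and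
Remark 3.4) bounds `χ(K²) ≤ χ(UD(𝔽₃²)) = 3` for every field `K` inside `ℚ₃` OR inside a RAMIFIED quadratic extension
`ℚ₃(√3)`, `ℚ₃(√6)` (residue field still `𝔽₃`, in which `−1` is not a square); the tree had the `ℚ₃` case (`PadicReduction`,
udg g5) and the abstract valuation-ring form (`ValuationRingReduction`).  This file supplies the ramified case without any
local-field theory: inside `Ω₃ = \overline{ℚ₃}` with Mathlib's spectral norm, a `Frame` is `g` with `g² = c ∈ ℚ₃`,
`‖c‖ = 1/3`; since `‖a‖ ∈ 3^ℤ` and `‖b·g‖ ∈ 3^{ℤ − 1/2}` never coincide, `‖a + b g‖ = max(‖a‖, ‖b‖‖g‖)` (`spN_pair`), so the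
unit ball of `L = ℚ₃(g)` is `{a + b g : a, b ∈ ℤ₃}` and `a + b g ↦ a mod 3` is a ring homomorphism onto `ZMod 3` killing the
maximal ideal (`Frame.resHom`, `Frame.residueToZMod3`).  With `colorable_three_of_valuationSubring_zmod3` (udg g5):
every graph with coordinates in `L` and unit-quadrance edges is `3`-colourable (`Frame.colorable_three`).
The two frames `g² = 3` and `g² = 6` exist trivially (`frame3`, `frame6`).  Nothing here is literature.
-/

noncomputable section

namespace Summit.Ventures.DiscreteObjects.UnitDistance.ThreeAdic

open Spectral IntermediateField IsLocalRing
open scoped IntermediateField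

/-- An algebraic closure of `ℚ₃`. -/
abbrev Ω₃ : Type := AlgebraicClosure ℚ_[3]

/-- `Ω₃` has characteristic zero. -/
instance : CharZero Ω₃ := charZero_of_injective_algebraMap (algebraMap ℚ_[3] Ω₃).injective

/-! ## Norms in `ℚ₃` -/

/-- `‖3‖₃ = 1/3`. -/
theorem norm_three : ‖(3 : ℚ_[3])‖ = 3⁻¹ := by simpa using Padic.norm_p (p := 3)

/-- `‖2‖₃ = 1`. -/
theorem norm_two : ‖(2 : ℚ_[3])‖ = 1 := by
  have h := Padic.norm_int_le_one (p := 3) 2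
  have h' : ¬ ‖((2 : ℤ) : ℚ_[3])‖ < 1 := by rw [Padic.norm_intCast_lt_one_iff]; decide
  push_cast at h h'
  exact le_antisymm h (not_lt.1 h')

/-- `‖6‖₃ = 1/3`. -/
theorem norm_six : ‖(6 : ℚ_[3])‖ = 3⁻¹ := by
  rw [show (6 : ℚ_[3]) = 2 * 3 by norm_num, norm_mul, norm_two, norm_three, one_mul]

/-- Norms of nonzero `3`-adic numbers are integral powers of `3`. -/
theorem exists_norm_eq_zpow {c : ℚ_[3]} (hc : c ≠ 0) : ∃ a : ℤ, ‖c‖ = (3 : ℝ) ^ a :=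
  ⟨-c.valuation, by rw [Padic.norm_eq_zpow_neg_valuation hc]; norm_cast⟩

/-- A `3`-adic number of norm `> 1` has norm `≥ 3`. -/
theorem three_le_norm_of_one_lt {b : ℚ_[3]} (h : 1 < ‖b‖) : 3 ≤ ‖b‖ := by
  have hb : b ≠ 0 := by rintro rfl; norm_num at h
  obtain ⟨a, ha⟩ := exists_norm_eq_zpow hb
  rw [ha] at h ⊢
  have ha1 : 1 ≤ a := by
    have := (one_lt_zpow_iff_right₀ (by norm_num : (1 : ℝ) < 3)).1 h
    omega
  calc (3 : ℝ) = (3 : ℝ) ^ (1 : ℤ) := by norm_num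
    _ ≤ (3 : ℝ) ^ a := zpow_le_zpow_right₀ (by norm_num) ha1

/-- `‖3‖ = 1/3` in `Ω₃`. -/
theorem spN_three : spN ℚ_[3] (3 : Ω₃) = 3⁻¹ := by
  have h : (3 : Ω₃) = (algebraMap ℚ_[3] Ω₃) 3 := (map_ofNat (algebraMap ℚ_[3] Ω₃) 3).symm
  rw [h, spN_algebraMap, norm_three]

/-! ## Frames: `g² = c`, `‖c‖ = 1/3` -/

/-- A RAMIFIED QUADRATIC FRAME over `ℚ₃`: `g ∈ Ω₃` with `g² = c ∈ ℚ₃` of norm `1/3` (so `‖g‖ = 3^{-1/2}`). -/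
structure Frame where
  /-- the generator -/
  g : Ω₃
  /-- its square, in `ℚ₃` -/
  c : ℚ_[3]
  /-- `g² = c` -/
  hg : g ^ 2 = algebraMap ℚ_[3] Ω₃ c
  /-- `‖c‖ = 1/3` -/
  hc : ‖c‖ = 3⁻¹

variable (F : Frame)

/-- `‖g‖² = 1/3`. -/
theorem Frame.spN_g_sq : spN ℚ_[3] F.g ^ 2 = 3⁻¹ := by
  rw [← spN_pow, F.hg, spN_algebraMap, F.hc]

/-- `‖g‖ > 0`. -/
theorem Frame.spN_g_pos : 0 < spN ℚ_[3] F.g := by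
  have h := F.spN_g_sq
  have h0 := spN_nonneg ℚ_[3] F.g
  by_contra hle
  have : spN ℚ_[3] F.g = 0 := le_antisymm (not_lt.1 hle) h0
  rw [this] at h; norm_num at h

/-- `c ≠ 0`. -/
theorem Frame.c_ne_zero : F.c ≠ 0 := by
  intro h; have := F.hc; rw [h, norm_zero] at this; norm_num at this

/-- VALUE GROUPS DIFFER: for nonzero `a, b ∈ ℚ₃`, `‖a‖ ≠ ‖b‖·‖g‖` (`3^{2m} ≠ 3^{2n−1}`). -/
theorem Frame.norm_ne {a b : ℚ_[3]} (ha : a ≠ 0) (hb : b ≠ 0) : ‖a‖ ≠ ‖b‖ * spN ℚ_[3] F.g := by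
  obtain ⟨m, hm⟩ := exists_norm_eq_zpow ha
  obtain ⟨n, hn⟩ := exists_norm_eq_zpow hb
  intro h
  have hsq : ‖a‖ ^ 2 = ‖b‖ ^ 2 * spN ℚ_[3] F.g ^ 2 := by rw [h]; ring
  rw [F.spN_g_sq, hm, hn] at hsq
  have e1 : ((3 : ℝ) ^ m) ^ 2 = (3 : ℝ) ^ (2 * m) := by
    rw [← zpow_natCast ((3 : ℝ) ^ m) 2, ← zpow_mul, mul_comm]; norm_num
  have e2 : ((3 : ℝ) ^ n) ^ 2 * (3 : ℝ)⁻¹ = (3 : ℝ) ^ (2 * n - 1) := by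
    rw [← zpow_natCast ((3 : ℝ) ^ n) 2, ← zpow_mul, ← zpow_neg_one, ← zpow_add₀ (by norm_num : (3 : ℝ) ≠ 0)]
    congr 1; push_cast; ring
  rw [e1, e2] at hsq
  have := zpow_right_injective₀ (by norm_num : (0 : ℝ) < 3) (by norm_num : (3 : ℝ) ≠ 1) hsq
  omega

/-- THE NORM FORMULA: `‖a + b·g‖ = max(‖a‖, ‖b‖·‖g‖)` for `a, b ∈ ℚ₃`. -/
theorem Frame.spN_pair (a b : ℚ_[3]) :
    spN ℚ_[3] (algebraMap ℚ_[3] Ω₃ a + algebraMap ℚ_[3] Ω₃ b * F.g) = max ‖a‖ (‖b‖ * spN ℚ_[3] F.g) := by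
  have hA : spN ℚ_[3] (algebraMap ℚ_[3] Ω₃ a) = ‖a‖ := spN_algebraMap ℚ_[3] a
  have hB : spN ℚ_[3] (algebraMap ℚ_[3] Ω₃ b * F.g) = ‖b‖ * spN ℚ_[3] F.g := by rw [spN_mul, spN_algebraMap]
  by_cases ha : a = 0
  · subst ha
    simp only [map_zero, zero_add, norm_zero]
    rw [hB, max_eq_right (mul_nonneg (norm_nonneg b) (spN_nonneg ℚ_[3] F.g))]
  by_cases hb : b = 0
  · subst hb
    simp only [map_zero, zero_mul, add_zero, norm_zero, zero_mul]
    rw [hA, max_eq_left (norm_nonneg a)]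
  have hne : spN ℚ_[3] (algebraMap ℚ_[3] Ω₃ a) ≠ spN ℚ_[3] (algebraMap ℚ_[3] Ω₃ b * F.g) := by
    rw [hA, hB]; exact F.norm_ne ha hb
  rw [spN_add_eq_max_of_ne ℚ_[3] hne, hA, hB]

/-- UNIQUENESS OF COEFFICIENTS: `a + b g = a' + b' g` forces `a = a'`, `b = b'`. -/
theorem Frame.coeffs_unique {a b a' b' : ℚ_[3]}
    (h : algebraMap ℚ_[3] Ω₃ a + algebraMap ℚ_[3] Ω₃ b * F.g = algebraMap ℚ_[3] Ω₃ a' + algebraMap ℚ_[3] Ω₃ b' * F.g) :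
    a = a' ∧ b = b' := by
  have h0 : algebraMap ℚ_[3] Ω₃ (a - a') + algebraMap ℚ_[3] Ω₃ (b - b') * F.g = 0 := by
    rw [map_sub, map_sub]; linear_combination h
  have hn := F.spN_pair (a - a') (b - b')
  rw [h0, spN_zero] at hn
  have h1 : ‖a - a'‖ ≤ 0 := by rw [hn]; exact le_max_left _ _
  have h2 : ‖b - b'‖ * spN ℚ_[3] F.g ≤ 0 := by rw [hn]; exact le_max_right _ _
  have h2' : ‖b - b'‖ ≤ 0 := by
    by_contra hpos
    push Not at hpos
    have := mul_pos hpos F.spN_g_pos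
    exact absurd h2 (not_le.2 this)
  exact ⟨sub_eq_zero.1 (norm_le_zero_iff.1 h1), sub_eq_zero.1 (norm_le_zero_iff.1 h2')⟩

/-- INTEGRALITY OF COEFFICIENTS: `‖a + b g‖ ≤ 1 ⇒ ‖a‖ ≤ 1 ∧ ‖b‖ ≤ 1` (`‖b‖ ≤ √3` forces `‖b‖ ≤ 1` in `3^ℤ`). -/
theorem Frame.norm_coeff_le_one {a b : ℚ_[3]} (h : spN ℚ_[3] (algebraMap ℚ_[3] Ω₃ a + algebraMap ℚ_[3] Ω₃ b * F.g) ≤ 1) :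
    ‖a‖ ≤ 1 ∧ ‖b‖ ≤ 1 := by
  rw [F.spN_pair] at h
  refine ⟨(le_max_left _ _).trans h, ?_⟩
  by_contra hb
  push Not at hb
  have h3 : 3 ≤ ‖b‖ := three_le_norm_of_one_lt hb
  have hle : ‖b‖ * spN ℚ_[3] F.g ≤ 1 := (le_max_right _ _).trans h
  have hsq : (‖b‖ * spN ℚ_[3] F.g) ^ 2 ≤ 1 := by
    have h0 : 0 ≤ ‖b‖ * spN ℚ_[3] F.g := mul_nonneg (norm_nonneg b) (spN_nonneg ℚ_[3] F.g)
    nlinarith [hle, h0]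
  rw [mul_pow, F.spN_g_sq] at hsq
  nlinarith [h3, hsq, norm_nonneg b]

/-- `‖a + b g‖ < 1 ⇒ ‖a‖ < 1`. -/
theorem Frame.norm_fst_lt_one {a b : ℚ_[3]} (h : spN ℚ_[3] (algebraMap ℚ_[3] Ω₃ a + algebraMap ℚ_[3] Ω₃ b * F.g) < 1) :
    ‖a‖ < 1 := by
  rw [F.spN_pair] at h
  exact (le_max_left _ _).trans_lt h

/-! ## The field `L = ℚ₃(g)`, its unit ball as a valuation subring, and the residue map to `ZMod 3` -/

/-- The ramified quadratic field `L = ℚ₃(g) ⊂ Ω₃`. -/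
def Frame.L : IntermediateField ℚ_[3] Ω₃ := ℚ_[3]⟮F.g⟯

/-- Every element of `L` is `a + b g` with `a, b ∈ ℚ₃`. -/
theorem Frame.exists_coeffs (x : F.L) : ∃ ab : ℚ_[3] × ℚ_[3],
    (x : Ω₃) = algebraMap ℚ_[3] Ω₃ ab.1 + algebraMap ℚ_[3] Ω₃ ab.2 * F.g := by
  obtain ⟨a, b, h⟩ := MoserLocal.exists_coeffs_of_mem_adjoin_simple (F := ℚ_[3]) F.hg x.2
  exact ⟨(a, b), h⟩

/-- The coefficient pair of `x ∈ L`. -/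
def Frame.cf (x : F.L) : ℚ_[3] × ℚ_[3] := Classical.choose (F.exists_coeffs x)

/-- `x = (cf x).1 + (cf x).2 · g`. -/
theorem Frame.cf_spec (x : F.L) :
    (x : Ω₃) = algebraMap ℚ_[3] Ω₃ (F.cf x).1 + algebraMap ℚ_[3] Ω₃ (F.cf x).2 * F.g :=
  Classical.choose_spec (F.exists_coeffs x)

/-- The coefficient pair is determined by any representation. -/
theorem Frame.cf_eq {x : F.L} {a b : ℚ_[3]} (h : (x : Ω₃) = algebraMap ℚ_[3] Ω₃ a + algebraMap ℚ_[3] Ω₃ b * F.g) :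
    F.cf x = (a, b) := by
  have h' := F.cf_spec x
  rw [h] at h'
  obtain ⟨h1, h2⟩ := F.coeffs_unique h'.symm
  exact Prod.ext h1 h2

/-- `cf 1 = (1, 0)`. -/
theorem Frame.cf_one : F.cf 1 = (1, 0) := F.cf_eq (by simp)

/-- `cf 0 = (0, 0)`. -/
theorem Frame.cf_zero : F.cf 0 = (0, 0) := F.cf_eq (by simp)

/-- `cf (x + y) = cf x + cf y`. -/
theorem Frame.cf_add (x y : F.L) : F.cf (x + y) = ((F.cf x).1 + (F.cf y).1, (F.cf x).2 + (F.cf y).2) := by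
  apply F.cf_eq
  rw [IntermediateField.coe_add, F.cf_spec x, F.cf_spec y, map_add, map_add]; ring

/-- `cf (x * y) = (a a' + b b' c, a b' + a' b)`. -/
theorem Frame.cf_mul (x y : F.L) : F.cf (x * y) =
    ((F.cf x).1 * (F.cf y).1 + (F.cf x).2 * (F.cf y).2 * F.c, (F.cf x).1 * (F.cf y).2 + (F.cf y).1 * (F.cf x).2) := by
  apply F.cf_eq
  rw [IntermediateField.coe_mul, F.cf_spec x, F.cf_spec y]
  simp only [map_add, map_mul]
  linear_combination (algebraMap ℚ_[3] Ω₃ (F.cf x).2) * (algebraMap ℚ_[3] Ω₃ (F.cf y).2) * F.hg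

/-- THE UNIT BALL of `L` (for the spectral norm) as a VALUATION SUBRING of `L`. -/
def Frame.O : ValuationSubring F.L where
  carrier := {x | spN ℚ_[3] (x : Ω₃) ≤ 1}
  mul_mem' {x y} hx hy := by
    simp only [Set.mem_setOf_eq] at hx hy ⊢
    rw [IntermediateField.coe_mul, spN_mul]
    exact mul_le_one₀ hx (spN_nonneg ℚ_[3] _) hy
  one_mem' := by simp only [Set.mem_setOf_eq, IntermediateField.coe_one, spN_one ℚ_[3]]; exact le_rfl
  add_mem' {x y} hx hy := by
    simp only [Set.mem_setOf_eq] at hx hy ⊢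
    rw [IntermediateField.coe_add]
    exact (spN_add_le ℚ_[3] _ _).trans (max_le hx hy)
  zero_mem' := by simp only [Set.mem_setOf_eq, IntermediateField.coe_zero, spN_zero ℚ_[3]]; exact zero_le_one
  neg_mem' {x} hx := by
    simp only [Set.mem_setOf_eq] at hx ⊢
    rwa [IntermediateField.coe_neg, spN_neg]
  mem_or_inv_mem' x := by
    by_cases hx : spN ℚ_[3] (x : Ω₃) ≤ 1
    · exact Or.inl hx
    · right
      change spN ℚ_[3] ((x⁻¹ : F.L) : Ω₃) ≤ 1
      rw [IntermediateField.coe_inv, spN_inv]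
      exact inv_le_one_of_one_le₀ (le_of_lt (not_le.mp hx))

/-- Membership in `O`. -/
theorem Frame.mem_O_iff {x : F.L} : x ∈ F.O ↔ spN ℚ_[3] (x : Ω₃) ≤ 1 := Iff.rfl

/-- Elements of `O` have `3`-adically integral coefficients. -/
theorem Frame.norm_cf_le_one {x : F.L} (hx : x ∈ F.O) : ‖(F.cf x).1‖ ≤ 1 ∧ ‖(F.cf x).2‖ ≤ 1 := by
  rw [F.mem_O_iff, F.cf_spec x] at hx
  exact F.norm_coeff_le_one hx

/-- The first coefficient of `x ∈ O`, as a `3`-adic integer. -/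
def Frame.fstInt (x : F.O) : ℤ_[3] := ⟨(F.cf x.1).1, (F.norm_cf_le_one x.2).1⟩

/-- `toZMod` kills `3`-adic integers of norm `< 1`. -/
theorem toZMod_eq_zero_of_norm_lt_one {z : ℤ_[3]} (hz : ‖z‖ < 1) : PadicInt.toZMod z = 0 := by
  rw [← RingHom.mem_ker, PadicInt.ker_toZMod, IsLocalRing.mem_maximalIdeal, mem_nonunits_iff]
  exact PadicInt.mem_nonunits.2 hz

/-- THE RESIDUE MAP `O → ZMod 3`, `a + b g ↦ a mod 3` (a ring homomorphism because `‖b b' c‖ ≤ 1/3`). -/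
def Frame.resHom : F.O →+* ZMod 3 where
  toFun x := PadicInt.toZMod (F.fstInt x)
  map_one' := by
    have h : F.fstInt 1 = 1 := by
      apply Subtype.ext
      change (F.cf ((1 : F.O) : F.L)).1 = 1
      rw [OneMemClass.coe_one, F.cf_one]
    rw [h, map_one]
  map_mul' x y := by
    have hc : ‖F.c‖ ≤ 1 := by rw [F.hc]; norm_num
    have h : F.fstInt (x * y) = F.fstInt x * F.fstInt y +
        ⟨(F.cf x.1).2, (F.norm_cf_le_one x.2).2⟩ * ⟨(F.cf y.1).2, (F.norm_cf_le_one y.2).2⟩ * ⟨F.c, hc⟩ := by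
      apply Subtype.ext
      change (F.cf ((x * y : F.O) : F.L)).1 = _
      rw [MulMemClass.coe_mul, F.cf_mul]
      rfl
    rw [h, map_add, map_mul, map_mul, map_mul]
    have hc0 : PadicInt.toZMod (⟨F.c, hc⟩ : ℤ_[3]) = 0 :=
      toZMod_eq_zero_of_norm_lt_one (by change ‖F.c‖ < 1; rw [F.hc]; norm_num)
    rw [hc0, mul_zero, add_zero]
  map_zero' := by
    have h : F.fstInt 0 = 0 := by
      apply Subtype.ext
      change (F.cf ((0 : F.O) : F.L)).1 = 0
      rw [ZeroMemClass.coe_zero, F.cf_zero]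
    rw [h, map_zero]
  map_add' x y := by
    have h : F.fstInt (x + y) = F.fstInt x + F.fstInt y := by
      apply Subtype.ext
      change (F.cf ((x + y : F.O) : F.L)).1 = _
      rw [AddMemClass.coe_add, F.cf_add]
      rfl
    rw [h, map_add]

/-- Elements of the maximal ideal of `O` have norm `< 1` (norm-one elements are units of `O`). -/
theorem Frame.spN_lt_one_of_mem_maximalIdeal {x : F.O} (hx : x ∈ maximalIdeal F.O) : spN ℚ_[3] ((x : F.L) : Ω₃) < 1 := by
  rcases (show spN ℚ_[3] ((x : F.L) : Ω₃) ≤ 1 from x.2).lt_or_eq with hlt | heq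
  · exact hlt
  · exfalso
    have hx0 : ((x : F.L) : Ω₃) ≠ 0 := by
      intro h0; rw [h0, spN_zero] at heq; norm_num at heq
    have hxL : (x : F.L) ≠ 0 := fun h0 => hx0 (by rw [h0]; rfl)
    have hinv : (x : F.L)⁻¹ ∈ F.O := by
      rw [F.mem_O_iff, IntermediateField.coe_inv, spN_inv, heq, inv_one]
    have hunit : IsUnit x := by
      refine IsUnit.of_mul_eq_one ⟨(x : F.L)⁻¹, hinv⟩ ?_
      apply Subtype.ext
      change (x : F.L) * (x : F.L)⁻¹ = 1
      exact mul_inv_cancel₀ hxL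
    exact (IsLocalRing.mem_maximalIdeal _ |>.1 hx) hunit

/-- The residue map kills the maximal ideal. -/
theorem Frame.resHom_eq_zero {x : F.O} (hx : x ∈ maximalIdeal F.O) : F.resHom x = 0 := by
  have hlt := F.spN_lt_one_of_mem_maximalIdeal hx
  rw [F.cf_spec] at hlt
  have ha : ‖(F.cf (x : F.L)).1‖ < 1 := F.norm_fst_lt_one hlt
  exact toZMod_eq_zero_of_norm_lt_one ha

/-- THE RESIDUE FIELD OF `O` MAPS TO `ZMod 3` (indeed isomorphically). -/
def Frame.residueToZMod3 : ResidueField F.O →+* ZMod 3 :=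
  Ideal.Quotient.lift (maximalIdeal F.O) F.resHom fun _ hx => F.resHom_eq_zero hx

/-- THE LOCAL THEOREM: every graph with vertex coordinates `x v, y v ∈ L = ℚ₃(g)` and unit-quadrance edges is
`3`-colourable (Madore's reduction to `UD(𝔽₃²)`, `χ = 3`, through the valuation ring `O`). -/
theorem Frame.colorable_three {V : Type*} {G : SimpleGraph V} (x y : V → F.L)
    (hadj : ∀ ⦃v w : V⦄, G.Adj v w → (x v - x w) ^ 2 + (y v - y w) ^ 2 = 1) : G.Colorable 3 :=
  colorable_three_of_valuationSubring_zmod3 F.O (fun v => (x v, y v)) F.residueToZMod3 hadj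

/-! ## The two frames exist -/

/-- The frame `g² = 3` (the field `ℚ₃(√3)`). -/
def frame3 : Frame :=
  ⟨Classical.choose (IsAlgClosed.exists_pow_nat_eq (3 : Ω₃) two_pos), 3,
    by rw [Classical.choose_spec (IsAlgClosed.exists_pow_nat_eq (3 : Ω₃) two_pos), map_ofNat], norm_three⟩

/-- The frame `g² = 6` (the field `ℚ₃(√6)`). -/
def frame6 : Frame :=
  ⟨Classical.choose (IsAlgClosed.exists_pow_nat_eq (6 : Ω₃) two_pos), 6,
    by rw [Classical.choose_spec (IsAlgClosed.exists_pow_nat_eq (6 : Ω₃) two_pos), map_ofNat], norm_six⟩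

/-- `frame3.g ^ 2 = 3`. -/
theorem frame3_g_sq : frame3.g ^ 2 = (3 : Ω₃) := by rw [frame3.hg]; change algebraMap ℚ_[3] Ω₃ 3 = 3; rw [map_ofNat]

/-- `frame6.g ^ 2 = 6`. -/
theorem frame6_g_sq : frame6.g ^ 2 = (6 : Ω₃) := by rw [frame6.hg]; change algebraMap ℚ_[3] Ω₃ 6 = 6; rw [map_ofNat]

end Summit.Ventures.DiscreteObjects.UnitDistance.ThreeAdic
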